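import Literature.MathematicalPhysics.QuantumFieldTheory.LatticeMaxwellGaussian
import HarnessLib

/-!
# Lattice Maxwell theory: Theorem 14.3 (the multiscale lower bound for the sup-norm)

S. Chatterjee, *The leading term of the Yang–Mills free energy*, J. Funct. Anal. 271 (2016),
arXiv:1602.01222, Theorem 14.3 — sixth step of the inline proof of the named fact
`Literature.MathematicalPhysics.QuantumFieldTheory.chatterjee_freeEnergyDensity`. Everything is
proved; no named fact is introduced.

For the fine box `B_n`, `n = r(m-1)+1`, tiled by `r^d` face-sharing translates of `B_m`
(`LatticeMaxwellGaussian`: `Amb m r`, `IsBdry`, `blk`, `corner`, `pinB`, `Pb`, `eqv`,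
`formM_amb_add_eq`), the axial-gauge lattice Maxwell measure `τ_n = τ pinI 0 n` satisfies

  `τ_n(|t_e| ≤ R' ∀ e) ≥ 2^{-r^d} · (2η (c_n/2π)^{1/2} e^{-C_n η²/2})^{|A|}`

(`theorem_14_3`) whenever `0 < η ≤ R'`, `R ≤ R'` and `R` dominates the Theorem-14.2 radius of every
block (`Rθ_le_R0` gives the uniform polynomial radius `R0 d m η`), where `A` is the set of free
edges with an endpoint on a block boundary, `|A| ≤ 4d² n^d/(m-1)` (`card_Abdry_le_real`). This is
the printed `τ_n(…) ≥ exp(-C n^d log n / m)` with explicit constants.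

Proof as printed: pin the edges of `A` to `|t_e| ≤ η` (Theorem 14.1, `theorem_14_1`), then treat
the blocks one at a time: conditionally on everything outside the interior of a block, the
interior is the block's own Gaussian with boundary values read from `A` (form decomposition
`formM_amb_add_eq`, index transport `eqv`/`φb`), so Theorem 14.2 (`theorem_14_2`) bounds the
sup-norm there by `R` with conditional probability `≥ 1/2` (`inner_block`); a half-step Fubini
lemma (`lintegral_le_two_mul_of_sections`) and induction over the blocks (`Iint_empty_le`) give the
factor `2^{-r^d}`.

## References

* S. Chatterjee, *The leading term of the Yang–Mills free energy*, J. Funct. Anal. 271 (2016)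
  2944–3005, arXiv:1602.01222, §14, Theorem 14.3 and its proof. [arXiv160201222]
-/

noncomputable section

open MeasureTheory Measure ProbabilityTheory Finset Matrix WithLp
open scoped ENNReal NNReal
open Literature.Probability.LatticeModels Literature.MathematicalPhysics.QuantumLattice

namespace Literature.MathematicalPhysics.QuantumFieldTheory

namespace LatticeMaxwell

open AxialGauge WilsonWeakCoupling GaussianToolkit

variable {d : ℕ}

/-- Sites of `ℤ^d`. -/
local notation "ZSite" => Literature.Probability.LatticeModels.Site

/-! ### A half-step Fubini lemma -/

section HalfStep

variable {ι : Type*} [Fintype ι]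

/-- **Half-step Fubini lemma**: if `F` depends only on the coordinates outside `P` and, for every
value `u` of those coordinates with `F ≠ 0`, the section integral of `W` is at most twice the
section integral over the cube `{|s_i| ≤ R}` in the `P`-coordinates, then
`∫ F W ≤ 2 ∫ F 1_{|t_i| ≤ R, i ∈ P} W`. [folklore] -/
theorem lintegral_le_two_mul_of_sections (P : ι → Prop) [DecidablePred P]
    {W F : (ι → ℝ) → ℝ≥0∞} (hW : Measurable W) (hF : Measurable F)
    (hFdep : ∀ t t' : ι → ℝ, (∀ i, ¬ P i → t i = t' i) → F t = F t') (R : ℝ)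
    (hinner : ∀ u : {i // ¬ P i} → ℝ,
      F ((MeasurableEquiv.piEquivPiSubtypeProd (fun _ : ι => ℝ) P).symm (0, u)) ≠ 0 →
      ∫⁻ s, W ((MeasurableEquiv.piEquivPiSubtypeProd (fun _ : ι => ℝ) P).symm (s, u)) ≤
        2 * ∫⁻ s in {s : {i // P i} → ℝ | ∀ i, |s i| ≤ R},
          W ((MeasurableEquiv.piEquivPiSubtypeProd (fun _ : ι => ℝ) P).symm (s, u))) :
    ∫⁻ t, F t * W t ≤ 2 * ∫⁻ t, F t * ({t : ι → ℝ | ∀ i, P i → |t i| ≤ R}.indicator W t) := by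
  set e := MeasurableEquiv.piEquivPiSubtypeProd (fun _ : ι => ℝ) P with he
  have hmp : MeasurePreserving e.symm ((volume : Measure ({i // P i} → ℝ)).prod volume) volume :=
    (volume_preserving_piEquivPiSubtypeProd (fun _ : ι => ℝ) P).symm
  set cube := {s : {i // P i} → ℝ | ∀ i, |s i| ≤ R} with hcube
  have hcubem : MeasurableSet cube := by
    have : cube = ⋂ i, {s : {i // P i} → ℝ | |s i| ≤ R} := by ext; simp [hcube]
    rw [this]; exact MeasurableSet.iInter fun i => measurableSet_le (by fun_prop) measurable_const
  set E := {t : ι → ℝ | ∀ i, P i → |t i| ≤ R} with hE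
  have hEm : MeasurableSet E := by
    have : E = ⋂ i, {t : ι → ℝ | P i → |t i| ≤ R} := by ext; simp [hE]
    rw [this]
    refine MeasurableSet.iInter fun i => ?_
    by_cases hP : P i
    · simp only [hP, forall_true_left]; exact measurableSet_le (by fun_prop) measurable_const
    · simp [hP]
  have hind : ∀ (s : {i // P i} → ℝ) (u : {i // ¬ P i} → ℝ),
      E.indicator W (e.symm (s, u)) = cube.indicator (fun s => W (e.symm (s, u))) s := by
    intro s u
    have hmem : e.symm (s, u) ∈ E ↔ s ∈ cube := by
      simp only [hE, hcube, Set.mem_setOf_eq, he, MeasurableEquiv.piEquivPiSubtypeProd,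
        MeasurableEquiv.symm_mk, MeasurableEquiv.coe_mk, Equiv.piEquivPiSubtypeProd_symm_apply]
      constructor
      · intro h i; have := h i.1 i.2; simpa [i.2] using this
      · intro h i hi; simpa [hi] using h ⟨i, hi⟩
    by_cases hs : s ∈ cube
    · rw [Set.indicator_of_mem hs, Set.indicator_of_mem (hmem.2 hs)]
    · rw [Set.indicator_of_notMem hs, Set.indicator_of_notMem (fun h => hs (hmem.1 h))]
  have hFu : ∀ (s : {i // P i} → ℝ) (u : {i // ¬ P i} → ℝ), F (e.symm (s, u)) = F (e.symm (0, u)) := by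
    intro s u
    apply hFdep
    intro i hi
    simp [he, MeasurableEquiv.piEquivPiSubtypeProd, Equiv.piEquivPiSubtypeProd_symm_apply, hi]
  have hL : ∫⁻ t, F t * W t = ∫⁻ u, ∫⁻ s, F (e.symm (0, u)) * W (e.symm (s, u)) := by
    rw [← hmp.lintegral_comp_emb e.symm.measurableEmbedding]
    have h1 : AEMeasurable (fun a : ({i // P i} → ℝ) × ({i // ¬ P i} → ℝ) => F (e.symm a) * W (e.symm a))
        ((volume : Measure ({i // P i} → ℝ)).prod volume) :=
      ((hF.comp e.symm.measurable).mul (hW.comp e.symm.measurable)).aemeasurable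
    rw [lintegral_prod_symm _ h1]
    exact lintegral_congr fun u => lintegral_congr fun s => by rw [hFu]
  have hR : ∫⁻ t, F t * E.indicator W t = ∫⁻ u, ∫⁻ s, F (e.symm (0, u)) * cube.indicator (fun s => W (e.symm (s, u))) s := by
    rw [← hmp.lintegral_comp_emb e.symm.measurableEmbedding]
    have h1 : AEMeasurable (fun a : ({i // P i} → ℝ) × ({i // ¬ P i} → ℝ) => F (e.symm a) * E.indicator W (e.symm a))
        ((volume : Measure ({i // P i} → ℝ)).prod volume) :=
      ((hF.comp e.symm.measurable).mul ((hW.indicator hEm).comp e.symm.measurable)).aemeasurable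
    rw [lintegral_prod_symm _ h1]
    exact lintegral_congr fun u => lintegral_congr fun s => by rw [hFu, hind]
  rw [hL, hR, ← lintegral_const_mul' _ _ ENNReal.ofNat_ne_top]
  refine lintegral_mono fun u => ?_
  have hWs : Measurable fun s : {i // P i} → ℝ => W (e.symm (s, u)) :=
    hW.comp (e.symm.measurable.comp (measurable_id.prodMk measurable_const))
  rw [lintegral_const_mul _ hWs, lintegral_const_mul _ (hWs.indicator hcubem), lintegral_indicator hcubem]
  by_cases h0 : F (e.symm (0, u)) = 0
  · simp [h0]
  · calc F (e.symm (0, u)) * ∫⁻ s, W (e.symm (s, u)) ≤ F (e.symm (0, u)) * (2 * ∫⁻ s in cube, W (e.symm (s, u))) :=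
        mul_le_mul_right (hinner u h0) _
      _ = 2 * (F (e.symm (0, u)) * ∫⁻ s in cube, W (e.symm (s, u))) := by ring

end HalfStep

/-! ### Theorem 14.3: the per-block step -/

section PerBlock

variable {m r : ℕ}

/-- The ambient weight `e^{-½ M(t)}` on `ℝ^{free edges of B_n}`. [cite: arXiv160201222, §13] -/
def Wamb (m r : ℕ) (t : Amb (d := d) m r → ℝ) : ℝ≥0∞ :=
  ENNReal.ofReal (Real.exp (-(formM pinI (0 : ZSite d) (fineN m r) 0 t) / 2))

/-- The ambient weight is measurable. [folklore] -/
theorem measurable_Wamb : Measurable (Wamb (d := d) m r) := by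
  unfold Wamb
  refine ENNReal.measurable_ofReal.comp (Real.measurable_exp.comp ?_)
  exact ((continuous_formM _).measurable.neg).div_const _

/-- The splitting of the ambient coordinates at block `b`. [folklore] -/
abbrev spl (m r : ℕ) (b : Fin d → ℤ) :=
  MeasurableEquiv.piEquivPiSubtypeProd (fun _ : Amb (d := d) m r => ℝ) (Pb m b)

/-- Glued configurations with the same outer part agree off the interior of `b`. [folklore] -/
theorem spl_symm_agree (b : Fin d → ℤ) (s s' : {i : Amb (d := d) m r // Pb m b i} → ℝ)
    (u : {i : Amb (d := d) m r // ¬ Pb m b i} → ℝ) :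
    ∀ i, ¬ Pb m b i → (spl m r b).symm (s, u) i = (spl m r b).symm (s', u) i := by
  intro i hi
  simp [MeasurableEquiv.piEquivPiSubtypeProd, Equiv.piEquivPiSubtypeProd_symm_apply, hi]

/-- The glued configuration at an interior index. [folklore] -/
theorem spl_symm_apply_of_pb (b : Fin d → ℤ) (s : {i : Amb (d := d) m r // Pb m b i} → ℝ)
    (u : {i : Amb (d := d) m r // ¬ Pb m b i} → ℝ) (i : {i : Amb (d := d) m r // Pb m b i}) :
    (spl m r b).symm (s, u) i.1 = s i := by
  simp [MeasurableEquiv.piEquivPiSubtypeProd, Equiv.piEquivPiSubtypeProd_symm_apply, i.2]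

/-- The glued configuration at an outer index. [folklore] -/
theorem spl_symm_apply_of_not_pb (b : Fin d → ℤ) (s : {i : Amb (d := d) m r // Pb m b i} → ℝ)
    (u : {i : Amb (d := d) m r // ¬ Pb m b i} → ℝ) (i : {i : Amb (d := d) m r // ¬ Pb m b i}) :
    (spl m r b).symm (s, u) i.1 = u i := by
  simp [MeasurableEquiv.piEquivPiSubtypeProd, Equiv.piEquivPiSubtypeProd_symm_apply, i.2]

/-- The transport of the interior coordinates to the free block coordinates. [folklore] -/
abbrev φb (hm : 2 ≤ m) {b : Fin d → ℤ} (hb : ∀ k, 0 ≤ b k ∧ b k < r) :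
    ({i : Amb (d := d) m r // Pb m b i} → ℝ) ≃ᵐ (Free (pinB m b) (corner m b) m → ℝ) :=
  MeasurableEquiv.piCongrLeft (fun _ => ℝ) (eqv hm hb)

/-- `φb s e' = s (eqv⁻¹ e')`. [folklore] -/
theorem φb_apply (hm : 2 ≤ m) {b : Fin d → ℤ} (hb : ∀ k, 0 ≤ b k ∧ b k < r)
    (s : {i : Amb (d := d) m r // Pb m b i} → ℝ) (e' : Free (pinB m b) (corner m b) m) :
    φb hm hb s e' = s ((eqv hm hb).symm e') := by
  rw [φb, MeasurableEquiv.coe_piCongrLeft]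
  conv_lhs => rw [← (eqv hm hb).apply_symm_apply e']
  rw [Equiv.piCongrLeft_apply_apply]

/-- `φb` preserves Lebesgue measure. [folklore] -/
theorem measurePreserving_φb (hm : 2 ≤ m) {b : Fin d → ℤ} (hb : ∀ k, 0 ≤ b k ∧ b k < r) :
    MeasurePreserving (φb (d := d) hm hb) volume volume := by
  have h := measurePreserving_piCongrLeft (fun _ : Free (pinB m b) (corner m b) m => (volume : Measure ℝ)) (eqv hm hb)
  simpa [φb, volume_pi] using h

/-- The block values of a glued configuration are the transported interior coordinates. [folklore] -/
theorem tB_spl_symm (hm : 2 ≤ m) {b : Fin d → ℤ} (hb : ∀ k, 0 ≤ b k ∧ b k < r)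
    (s : {i : Amb (d := d) m r // Pb m b i} → ℝ) (u : {i : Amb (d := d) m r // ¬ Pb m b i} → ℝ) :
    tB hm hb ((spl m r b).symm (s, u)) = φb hm hb s := by
  funext e'
  rw [tB, φb_apply, spl_symm_apply_of_pb]

/-- **The per-block step of Theorem 14.3**: for a valid block `b`, outer values `u` bounded by `η`
on the boundary edges, and `R ≥ Rθ` of the block, the section integral of `e^{-½M}` over the
interior coordinates is at most twice the section integral over `{|s| ≤ R}` (Theorem 14.2 applied
to the block with boundary condition read from `u`, after the form decomposition
`formM_amb_add_eq`). [cite: arXiv160201222, Thm. 14.3 (proof)] -/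
theorem inner_block (hm : 2 ≤ m) {b : Fin d → ℤ} (hb : ∀ k, 0 ≤ b k ∧ b k < r) {η R : ℝ} (hη : 0 ≤ η)
    (hR : Rθ (pinB m b) (corner m b) m η ≤ R) (u : {i : Amb (d := d) m r // ¬ Pb m b i} → ℝ)
    (hu : ∀ i : {i : Amb (d := d) m r // ¬ Pb m b i}, IsBdry m i.1.1.1 → |u i| ≤ η) :
    ∫⁻ s, Wamb m r ((spl m r b).symm (s, u)) ≤
      2 * ∫⁻ s in {s : {i : Amb (d := d) m r // Pb m b i} → ℝ | ∀ i, |s i| ≤ R}, Wamb m r ((spl m r b).symm (s, u)) := by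
  set t₀ := (spl m r b).symm (0, u) with ht₀
  set θ := ambE t₀ with hθ
  set K₁ := ∑ q ∈ ((plaquettesIn (halfOpenBox d m)).image (Plaq.shift (corner m b))).filter (fun q => ¬ Touches m b q), cq t₀ q with hK₁
  set K₂ := ∑ q ∈ (plaquettesIn (halfOpenBox d (fineN m r))).filter (fun q => ¬ Touches m b q), cq t₀ q with hK₂
  set C := ENNReal.ofReal (Real.exp ((K₁ - K₂) / 2)) with hC
  -- the weight factorises through the block weight
  have hfac : ∀ s, Wamb m r ((spl m r b).symm (s, u)) =
      C * wθ (pinB m b) (corner m b) m θ (WithLp.toLp 2 (φb hm hb s)) := by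
    intro s
    have hdec := formM_amb_add_eq hm hb ((spl m r b).symm (s, u)) t₀ (spl_symm_agree b s 0 u)
    rw [tB_spl_symm] at hdec
    rw [Wamb, wθ, hC, ← ENNReal.ofReal_mul (Real.exp_pos _).le, ← Real.exp_add, WithLp.ofLp_toLp]
    congr 2
    rw [← hθ, ← hK₁, ← hK₂] at hdec
    linarith
  -- boundary values are small on pinned block edges
  have hθb : ∀ e ∈ boxEdgesAt (corner m b) m, pinB m b e → |θ e| ≤ η := by
    refine abs_ambE_le_of_pin hm hb t₀ hη fun i hi => ?_
    have hnP : ¬ Pb m b i := fun hP => hP.1 hi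
    have : t₀ i = u ⟨i, hnP⟩ := spl_symm_apply_of_not_pb b 0 u ⟨i, hnP⟩
    rw [this]; exact hu ⟨i, hnP⟩ hi
  -- Theorem 14.2 for the block
  have h142 := theorem_14_2 (pin := pinB m b) (a := corner m b) (n := m) (hpinB b) hη hθb (θ := θ)
  -- transport both integrals
  set ψ : ({i : Amb (d := d) m r // Pb m b i} → ℝ) → EuclideanSpace ℝ (Free (pinB m b) (corner m b) m) :=
    fun s => WithLp.toLp 2 (φb hm hb s) with hψ
  have hψmp : MeasurePreserving ψ volume volume :=
    (PiLp.volume_preserving_toLp (Free (pinB m b) (corner m b) m)).comp (measurePreserving_φb hm hb)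
  have hψemb : MeasurableEmbedding ψ :=
    ((MeasurableEquiv.toLp 2 (Free (pinB m b) (corner m b) m → ℝ)).measurableEmbedding).comp (φb hm hb).measurableEmbedding
  have hwm : Measurable (wθ (pinB m b) (corner m b) m θ) := measurable_wθ θ
  have hmeasC : Measurable fun s : {i : Amb (d := d) m r // Pb m b i} → ℝ =>
      wθ (pinB m b) (corner m b) m θ (WithLp.toLp 2 (φb hm hb s)) := hwm.comp hψemb.measurable
  have hL : ∫⁻ s, Wamb m r ((spl m r b).symm (s, u)) = C * ∫⁻ y, wθ (pinB m b) (corner m b) m θ y := by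
    simp_rw [hfac]
    rw [lintegral_const_mul _ hmeasC]
    congr 1
    exact hψmp.lintegral_comp_emb hψemb _
  set cubeE := {y : EuclideanSpace ℝ (Free (pinB m b) (corner m b) m) | ∀ e, |y e| ≤ R} with hcubeE
  have hpre : ψ ⁻¹' cubeE = {s : {i : Amb (d := d) m r // Pb m b i} → ℝ | ∀ i, |s i| ≤ R} := by
    ext s
    simp only [Set.mem_preimage, hcubeE, Set.mem_setOf_eq, hψ, φb_apply]
    constructor
    · intro h i
      have := h (eqv hm hb i)
      rwa [Equiv.symm_apply_apply] at this
    · intro h e'; exact h _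
  have hRt : ∫⁻ s in {s : {i : Amb (d := d) m r // Pb m b i} → ℝ | ∀ i, |s i| ≤ R}, Wamb m r ((spl m r b).symm (s, u)) =
      C * ∫⁻ y in cubeE, wθ (pinB m b) (corner m b) m θ y := by
    simp_rw [hfac]
    rw [lintegral_const_mul _ hmeasC, ← hpre]
    congr 1
    exact hψmp.setLIntegral_comp_preimage_emb hψemb _ _
  rw [hL, hRt]
  -- monotonicity in the radius
  have hmono : ∫⁻ y in {y : EuclideanSpace ℝ (Free (pinB m b) (corner m b) m) | ∀ e, |y e| ≤ Rθ (pinB m b) (corner m b) m η},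
      wθ (pinB m b) (corner m b) m θ y ≤ ∫⁻ y in cubeE, wθ (pinB m b) (corner m b) m θ y :=
    lintegral_mono_set fun y hy e => (hy e).trans hR
  calc C * ∫⁻ y, wθ (pinB m b) (corner m b) m θ y
      ≤ C * (2 * ∫⁻ y in {y | ∀ e, |y e| ≤ Rθ (pinB m b) (corner m b) m η}, wθ (pinB m b) (corner m b) m θ y) := by
        gcongr
    _ ≤ C * (2 * ∫⁻ y in cubeE, wθ (pinB m b) (corner m b) m θ y) := by gcongr
    _ = 2 * (C * ∫⁻ y in cubeE, wθ (pinB m b) (corner m b) m θ y) := by ring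

end PerBlock

/-! ### Theorem 14.3: induction over the blocks and assembly -/

section Assembly

variable {m r : ℕ}

/-- Block labels `β ∈ (Fin r)^d` as integer vectors (always valid). [folklore] -/
def bz (β : Fin d → Fin r) : Fin d → ℤ := fun k => (β k : ℤ)

/-- `bz β` is a valid block. [folklore] -/
theorem bz_valid (β : Fin d → Fin r) : ∀ k, 0 ≤ bz β k ∧ bz β k < r := fun k =>
  ⟨by simp [bz], by simp [bz]⟩

/-- `bz` is injective. [folklore] -/
theorem bz_injective : Function.Injective (bz (d := d) (r := r)) := fun β β' h => by
  funext k
  have := congr_fun h k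
  simp only [bz, Nat.cast_inj] at this
  exact Fin.ext this

variable (m r) in
/-- The pinning event `E₁ = {|t_i| ≤ η on boundary edges}`. [cite: arXiv160201222, Thm. 14.3 (proof)] -/
def E1 (η : ℝ) : Set (Amb (d := d) m r → ℝ) := {t | ∀ i, IsBdry m i.1.1 → |t i| ≤ η}

variable (m r) in
/-- The block event `{|t_i| ≤ R on the interior of block β}`. [cite: arXiv160201222, Thm. 14.3 (proof)] -/
def EB (R : ℝ) (β : Fin d → Fin r) : Set (Amb (d := d) m r → ℝ) := {t | ∀ i, Pb m (bz β) i → |t i| ≤ R}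

variable (m r) in
/-- The event `E₁ ∩ ⋂_{β ∈ S} E_β`. [cite: arXiv160201222, Thm. 14.3 (proof)] -/
def ES (η R : ℝ) (S : Finset (Fin d → Fin r)) : Set (Amb (d := d) m r → ℝ) :=
  E1 m r η ∩ {t | ∀ β ∈ S, t ∈ EB m r R β}

/-- `E₁` is measurable. [folklore] -/
theorem measurableSet_E1 (η : ℝ) : MeasurableSet (E1 (d := d) m r η) := by
  have : E1 (d := d) m r η = ⋂ i, {t : Amb (d := d) m r → ℝ | IsBdry m i.1.1 → |t i| ≤ η} := by ext; simp [E1]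
  rw [this]
  refine MeasurableSet.iInter fun i => ?_
  by_cases h : IsBdry m i.1.1
  · simp only [h, forall_true_left]; exact measurableSet_le (by fun_prop) measurable_const
  · simp [h]

/-- `E_β` is measurable. [folklore] -/
theorem measurableSet_EB (R : ℝ) (β : Fin d → Fin r) : MeasurableSet (EB (d := d) m r R β) := by
  have : EB (d := d) m r R β = ⋂ i, {t : Amb (d := d) m r → ℝ | Pb m (bz β) i → |t i| ≤ R} := by ext; simp [EB]
  rw [this]
  refine MeasurableSet.iInter fun i => ?_
  by_cases h : Pb m (bz β) i
  · simp only [h, forall_true_left]; exact measurableSet_le (by fun_prop) measurable_const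
  · simp [h]

/-- `ES` is measurable. [folklore] -/
theorem measurableSet_ES (η R : ℝ) (S : Finset (Fin d → Fin r)) : MeasurableSet (ES (d := d) m r η R S) := by
  unfold ES
  refine (measurableSet_E1 η).inter ?_
  have : {t : Amb (d := d) m r → ℝ | ∀ β ∈ S, t ∈ EB m r R β} = ⋂ β ∈ S, EB m r R β := by ext; simp
  rw [this]
  exact MeasurableSet.biInter (Set.to_countable _) fun β _ => measurableSet_EB R β

variable (m r) in
/-- `I(S) = ∫_{E₁ ∩ ⋂_{β∈S} E_β} e^{-½M}`. [cite: arXiv160201222, Thm. 14.3 (proof)] -/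
def Iint (η R : ℝ) (S : Finset (Fin d → Fin r)) : ℝ≥0∞ := ∫⁻ t in ES m r η R S, Wamb m r t

/-- **The induction step**: `I(S) ≤ 2 I(S ∪ {β})`. [cite: arXiv160201222, Thm. 14.3 (proof)] -/
theorem Iint_le_two_mul_insert (hm : 2 ≤ m) {η R : ℝ} (hη : 0 ≤ η)
    (hR : ∀ b : Fin d → ℤ, (∀ k, 0 ≤ b k ∧ b k < r) → Rθ (pinB m b) (corner m b) m η ≤ R)
    (S : Finset (Fin d → Fin r)) {β : Fin d → Fin r} (hβ : β ∉ S) :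
    Iint m r η R S ≤ 2 * Iint m r η R (insert β S) := by
  classical
  set F : (Amb (d := d) m r → ℝ) → ℝ≥0∞ := (ES m r η R S).indicator 1 with hF
  have hFm : Measurable F := measurable_one.indicator (measurableSet_ES η R S)
  -- `F` depends only on coordinates outside the interior of `β`
  have hFdep : ∀ t t' : Amb (d := d) m r → ℝ, (∀ i, ¬ Pb m (bz β) i → t i = t' i) → F t = F t' := by
    intro t t' htt'
    have hiff : t ∈ ES m r η R S ↔ t' ∈ ES m r η R S := by
      simp only [ES, E1, EB, Set.mem_inter_iff, Set.mem_setOf_eq]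
      have h1 : ∀ i : Amb (d := d) m r, IsBdry m i.1.1 → t i = t' i := fun i hi => htt' i (fun hP => hP.1 hi)
      have h2 : ∀ β' ∈ S, ∀ i : Amb (d := d) m r, Pb m (bz β') i → t i = t' i := by
        intro β' hβ' i hP
        apply htt'
        intro hP2
        apply hβ
        have : bz β' = bz β := hP.2.symm.trans hP2.2
        rwa [← bz_injective this]
      constructor
      · rintro ⟨ha, hb⟩
        exact ⟨fun i hi => h1 i hi ▸ ha i hi, fun β' hβ' i hP => h2 β' hβ' i hP ▸ hb β' hβ' i hP⟩
      · rintro ⟨ha, hb⟩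
        exact ⟨fun i hi => (h1 i hi).symm ▸ ha i hi, fun β' hβ' i hP => (h2 β' hβ' i hP).symm ▸ hb β' hβ' i hP⟩
    by_cases ht : t ∈ ES m r η R S
    · rw [hF, Set.indicator_of_mem ht, Set.indicator_of_mem (hiff.1 ht), Pi.one_apply, Pi.one_apply]
    · rw [hF, Set.indicator_of_notMem ht, Set.indicator_of_notMem (fun h => ht (hiff.2 h))]
  have hstep := lintegral_le_two_mul_of_sections (Pb m (bz β)) (measurable_Wamb (m := m) (r := r)) hFm hFdep R
    (fun u hu0 => by
      refine inner_block hm (bz_valid β) hη (hR _ (bz_valid β)) u fun i hi => ?_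
      -- `F ≠ 0` at the glued point: the glued point is in `E₁`
      have hmem : (spl m r (bz β)).symm (0, u) ∈ ES m r η R S := by
        by_contra h
        exact hu0 (by rw [hF, Set.indicator_of_notMem h])
      have h1 := hmem.1 i.1 hi
      rwa [spl_symm_apply_of_not_pb] at h1)
  -- identify both sides
  have hL : ∫⁻ t, F t * Wamb m r t = Iint m r η R S := by
    rw [Iint, ← lintegral_indicator (measurableSet_ES η R S)]
    refine lintegral_congr fun t => ?_
    by_cases ht : t ∈ ES m r η R S
    · rw [hF, Set.indicator_of_mem ht, Set.indicator_of_mem ht, Pi.one_apply, one_mul]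
    · rw [hF, Set.indicator_of_notMem ht, Set.indicator_of_notMem ht, zero_mul]
  have hRi : ∫⁻ t, F t * {t : Amb (d := d) m r → ℝ | ∀ i, Pb m (bz β) i → |t i| ≤ R}.indicator (Wamb m r) t =
      Iint m r η R (insert β S) := by
    rw [Iint, ← lintegral_indicator (measurableSet_ES η R _)]
    refine lintegral_congr fun t => ?_
    have hiff : t ∈ ES m r η R (insert β S) ↔ t ∈ ES m r η R S ∧ t ∈ {t : Amb (d := d) m r → ℝ | ∀ i, Pb m (bz β) i → |t i| ≤ R} := by
      simp only [ES, EB, Set.mem_inter_iff, Set.mem_setOf_eq, Finset.forall_mem_insert]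
      tauto
    by_cases ht : t ∈ ES m r η R S
    · by_cases ht2 : t ∈ {t : Amb (d := d) m r → ℝ | ∀ i, Pb m (bz β) i → |t i| ≤ R}
      · rw [hF, Set.indicator_of_mem ht, Set.indicator_of_mem ht2, Set.indicator_of_mem (hiff.2 ⟨ht, ht2⟩),
          Pi.one_apply, one_mul]
      · rw [Set.indicator_of_notMem ht2, Set.indicator_of_notMem (fun h => ht2 (hiff.1 h).2), mul_zero]
    · rw [hF, Set.indicator_of_notMem ht, Set.indicator_of_notMem (fun h => ht (hiff.1 h).1), zero_mul]
  rw [← hL, ← hRi]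
  exact hstep

/-- **Induction over blocks**: `I(∅) ≤ 2^{|S|} I(S)`. [cite: arXiv160201222, Thm. 14.3 (proof)] -/
theorem Iint_empty_le (hm : 2 ≤ m) {η R : ℝ} (hη : 0 ≤ η)
    (hR : ∀ b : Fin d → ℤ, (∀ k, 0 ≤ b k ∧ b k < r) → Rθ (pinB m b) (corner m b) m η ≤ R)
    (S : Finset (Fin d → Fin r)) : Iint (d := d) m r η R ∅ ≤ 2 ^ S.card * Iint m r η R S := by
  classical
  induction S using Finset.induction_on with
  | empty => simp
  | insert β S hβ ih =>
    rw [Finset.card_insert_of_notMem hβ, pow_succ, mul_assoc]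
    exact ih.trans (mul_le_mul_right (Iint_le_two_mul_insert hm hη hR S hβ) _)

/-- Integrals of the ambient weight over events are `Z · τ` of the corresponding Euclidean events. [folklore] -/
theorem setLIntegral_Wamb_eq (G : Set (Amb (d := d) m r → ℝ)) (hG : MeasurableSet G) :
    ∫⁻ t in G, Wamb m r t =
      gaussZ (Qmat pinI (0 : ZSite d) (fineN m r)) *
        τ pinI (0 : ZSite d) (fineN m r) ((WithLp.ofLp) ⁻¹' G) := by
  obtain ⟨hτ, hZ0, hZtop⟩ := τ_eq_withDensity (pin := pinI) (a := (0 : ZSite d)) (n := fineN m r) (hpinI _)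
  set Q := Qmat pinI (0 : ZSite d) (fineN m r) with hQ
  have hW : (volume : Measure (EuclideanSpace ℝ (Amb (d := d) m r))).withDensity (gaussWeight Q) =
      gaussZ Q • τ pinI (0 : ZSite d) (fineN m r) := by
    rw [hτ, smul_smul, ENNReal.mul_inv_cancel hZ0 hZtop, one_smul]
  have hG' : MeasurableSet ((WithLp.ofLp) ⁻¹' G : Set (EuclideanSpace ℝ (Amb (d := d) m r))) :=
    (PiLp.continuous_ofLp 2 _).measurable hG
  have hmp := PiLp.volume_preserving_toLp (Amb (d := d) m r)
  have hemb := (MeasurableEquiv.toLp 2 (Amb (d := d) m r → ℝ)).measurableEmbedding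
  have hpre : (WithLp.toLp 2) ⁻¹' ((WithLp.ofLp) ⁻¹' G : Set (EuclideanSpace ℝ (Amb (d := d) m r))) = G := by
    ext t; simp
  calc ∫⁻ t in G, Wamb m r t
      = ∫⁻ t in (WithLp.toLp 2) ⁻¹' ((WithLp.ofLp) ⁻¹' G : Set (EuclideanSpace ℝ (Amb (d := d) m r))),
          gaussWeight Q (WithLp.toLp 2 t) := by
        rw [hpre]
        refine setLIntegral_congr_fun hG (fun t _ => ?_)
        rw [gaussWeight_Qmat, WithLp.ofLp_toLp, Wamb]
    _ = ∫⁻ y in (WithLp.ofLp) ⁻¹' G, gaussWeight Q y := hmp.setLIntegral_comp_preimage_emb hemb _ _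
    _ = ((volume : Measure (EuclideanSpace ℝ (Amb (d := d) m r))).withDensity (gaussWeight Q)) ((WithLp.ofLp) ⁻¹' G) :=
        (withDensity_apply _ hG').symm
    _ = gaussZ Q * τ pinI (0 : ZSite d) (fineN m r) ((WithLp.ofLp) ⁻¹' G) := by
        rw [hW, Measure.smul_apply, smul_eq_mul]

/-- The block index of a non-boundary free edge of the fine box is valid. [folklore] -/
theorem blk_valid (hm : 2 ≤ m) (i : Amb (d := d) m r) (hi : ¬ IsBdry m i.1.1) :
    ∀ k, 0 ≤ blk m i.1.1.1 k ∧ blk m i.1.1.1 k < r := by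
  intro k
  have hM : 0 < bM m := by unfold bM; omega
  have hmem := mem_boxEdgesAt_zero.1 i.1.2
  rw [mem_boxEdges] at hmem
  have hx := (mem_halfOpenBox.1 hmem.1) k
  have hs := (strict_endpoints hm hi k).1
  simp only [corner] at hs
  set q := blk m i.1.1.1 k
  have hbM : bM m = (m : ℤ) - 1 := rfl
  have hn : ((fineN m r : ℕ) : ℤ) = r * ((m : ℤ) - 1) + 1 := by
    simp only [fineN]; push_cast; rw [Nat.cast_sub (by omega)]; push_cast; ring
  rw [hn] at hx
  constructor
  · -- `x < (q+1) M` and `0 ≤ x` give `0 < (q + 1) M`, so `q ≥ 0`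
    have h1 : 0 < (q + 1) * bM m := by nlinarith [hx.1, hs.2]
    have h2 : 0 < q + 1 := pos_of_mul_pos_left h1 hM.le |> fun h => by
      rcases lt_or_ge 0 (q + 1) with h' | h'
      · exact h'
      · nlinarith
    omega
  · -- `q M < x ≤ r M`
    have h1 : q * bM m < r * bM m := by nlinarith [hx.2, hs.1]
    exact lt_of_mul_lt_mul_right h1 hM.le

/-- The block label of a non-boundary free edge. [folklore] -/
def βof (hm : 2 ≤ m) (i : Amb (d := d) m r) (hi : ¬ IsBdry m i.1.1) : Fin d → Fin r :=
  fun k => ⟨(blk m i.1.1.1 k).toNat, by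
    have h := blk_valid hm i hi k
    have : ((blk m i.1.1.1 k).toNat : ℤ) < r := by rw [Int.toNat_of_nonneg h.1]; exact h.2
    exact_mod_cast this⟩

/-- `bz (βof i) = blk i`. [folklore] -/
theorem bz_βof (hm : 2 ≤ m) (i : Amb (d := d) m r) (hi : ¬ IsBdry m i.1.1) : bz (βof hm i hi) = blk m i.1.1.1 := by
  funext k
  simp only [bz, βof]
  exact Int.toNat_of_nonneg (blk_valid hm i hi k).1

variable (m r) in
/-- The boundary free edges `A` of the fine box. [cite: arXiv160201222, Thm. 14.3 (proof), the set `A`] -/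
def Abdry : Finset (Amb (d := d) m r) := univ.filter fun i => IsBdry m i.1.1

/-- **Theorem 14.3 (multiscale lower bound for the sup-norm)**: for `n = r(m-1)+1`, `0 < η ≤ R'`,
`R ≤ R'` with `R` at least the Theorem-14.2 radius of every block,
`τ_n(|t_e| ≤ R' ∀ e) ≥ 2^{-r^d} (2η (c_n/2π)^{1/2} e^{-C_n η²/2})^{|A|}`
(printed: `≥ exp(-C n^d log n / m)` with `η = n^{-d/2}`, `C₁ m^{d+2} ≤ R`). [cite: arXiv160201222, Thm. 14.3] -/
theorem theorem_14_3 (hm : 2 ≤ m) {η R R' : ℝ} (hη : 0 < η) (hηR' : η ≤ R') (hRR' : R ≤ R')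
    (hR : ∀ b : Fin d → ℤ, (∀ k, 0 ≤ b k ∧ b k < r) → Rθ (pinB m b) (corner m b) m η ≤ R) :
    ENNReal.ofReal ((2 * η * (Real.sqrt (cLow d (fineN m r)) / Real.sqrt (2 * Real.pi)) *
        Real.exp (-(cUp d (fineN m r) * η ^ 2 / 2))) ^ (Abdry (d := d) m r).card) ≤
      2 ^ (r ^ d) * τ pinI (0 : ZSite d) (fineN m r) {y | ∀ i, |y i| ≤ R'} := by
  classical
  set n := fineN m r with hn
  set τA := τ pinI (0 : ZSite d) n with hτA
  obtain ⟨-, hZ0, hZtop⟩ := τ_eq_withDensity (pin := pinI) (a := (0 : ZSite d)) (n := n) (hpinI _)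
  set Z := gaussZ (Qmat pinI (0 : ZSite d) n) with hZ
  -- Theorem 14.1 for `E₁`
  have h141 := theorem_14_1 (pin := pinI) (a := (0 : ZSite d)) (n := n) (hpinI _) (Abdry (d := d) m r) hη
  have hE1 : {s : EuclideanSpace ℝ (Amb (d := d) m r) | ∀ e ∈ Abdry (d := d) m r, |s e| ≤ η} = (WithLp.ofLp) ⁻¹' E1 m r η := by
    ext s; simp [Abdry, E1]
  rw [hE1] at h141
  -- the induction over all blocks
  have hind := Iint_empty_le hm hη.le hR (univ : Finset (Fin d → Fin r))
  rw [Finset.card_univ, Fintype.card_fun, Fintype.card_fin, Fintype.card_fin] at hind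
  rw [Iint, Iint, setLIntegral_Wamb_eq _ (measurableSet_ES η R _), setLIntegral_Wamb_eq _ (measurableSet_ES η R _)] at hind
  -- `ES ∅ = E₁`, `ES univ ⊆ {|t| ≤ R'}`
  have hES0 : ES m r η R (∅ : Finset (Fin d → Fin r)) = E1 m r η := by
    ext t; simp [ES]
  rw [hES0] at hind
  have hsub : (WithLp.ofLp) ⁻¹' ES m r η R (univ : Finset (Fin d → Fin r)) ⊆
      {y : EuclideanSpace ℝ (Amb (d := d) m r) | ∀ i, |y i| ≤ R'} := by
    intro y hy i
    simp only [Set.mem_preimage, ES, E1, EB, Set.mem_inter_iff, Set.mem_setOf_eq, Finset.mem_univ, forall_true_left] at hy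
    by_cases hi : IsBdry m i.1.1
    · exact (hy.1 i hi).trans hηR'
    · refine (hy.2 (βof hm i hi) i ⟨hi, ?_⟩).trans hRR'
      rw [bz_βof]
  -- assemble: `Z τ(E₁) ≤ 2^{r^d} Z τ(ES univ) ≤ 2^{r^d} Z τ{≤ R'}`
  have hfin : Z * τA ((WithLp.ofLp) ⁻¹' E1 m r η) ≤ Z * (2 ^ (r ^ d) * τA {y | ∀ i, |y i| ≤ R'}) :=
    calc Z * τA ((WithLp.ofLp) ⁻¹' E1 m r η) ≤ 2 ^ (r ^ d) * (Z * τA ((WithLp.ofLp) ⁻¹' ES m r η R univ)) := hind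
      _ = Z * (2 ^ (r ^ d) * τA ((WithLp.ofLp) ⁻¹' ES m r η R univ)) := by ring
      _ ≤ Z * (2 ^ (r ^ d) * τA {y | ∀ i, |y i| ≤ R'}) := by gcongr
  exact h141.trans ((ENNReal.mul_le_mul_iff_right hZ0 hZtop).1 hfin)

end Assembly

/-! ### Theorem 14.3: the uniform radius and the size of `A` -/

section Counting

variable {m r : ℕ}

variable (d m) in
/-- A uniform Theorem-14.2 radius for all blocks: `R₀ = 16|B_m'|η/c_m + (2 log(4dm^d + 4)/c_m)^{1/2}`
(polynomial in `m`; printed `C₁ m^{d+2}`). [cite: arXiv160201222, Thm. 14.3 (proof), `R ≥ C₁ m^{d+2}`] -/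
def R0 (η : ℝ) : ℝ :=
  16 * #(plaquettesIn (halfOpenBox d m)) * η / cLow d m + Real.sqrt (2 * Real.log (4 * (d * (m : ℝ) ^ d) + 4) / cLow d m)

/-- `Rθ` of every block is at most `R₀`. [folklore] -/
theorem Rθ_le_R0 (b : Fin d → ℤ) (η : ℝ) : Rθ (pinB m b) (corner m b) m η ≤ R0 d m η := by
  have hcard : (Fintype.card (Free (pinB m b) (corner m b) m) : ℝ) ≤ d * (m : ℝ) ^ d := by
    have h1 : Fintype.card (Free (pinB m b) (corner m b) m) ≤ #(boxEdges d m) := by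
      rw [Fintype.card_subtype, ← card_boxEdgesAt (corner m b) m]
      exact (card_filter_le _ _).trans (by rw [Finset.card_univ, Fintype.card_coe])
    exact_mod_cast h1.trans (card_boxEdges_le m)
  have hc := (cLow_pos (d := d) (n := m)).le
  unfold Rθ R0
  gcongr

/-- The vertices of the fine box with `k`-th coordinate a multiple of `m - 1` number at most
`(r+1) n^{d-1}`. [folklore] -/
theorem card_filter_dvd_le (hm : 2 ≤ m) (k : Fin d) :
    #((halfOpenBox d (fineN m r)).filter fun x : ZSite d => bM m ∣ x k) ≤ (r + 1) * (fineN m r) ^ (d - 1) := by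
  classical
  have hM : 0 < bM m := by unfold bM; omega
  set n := fineN m r with hn
  set Mult : Finset ℤ := (Finset.range (r + 1)).image fun j : ℕ => (j : ℤ) * bM m with hMult
  have hsub : (halfOpenBox d n).filter (fun x : ZSite d => bM m ∣ x k) ⊆
      Fintype.piFinset (Function.update (fun _ : Fin d => Finset.Ico (0 : ℤ) n) k Mult) := by
    intro x hx
    rw [mem_filter, mem_halfOpenBox] at hx
    rw [Fintype.mem_piFinset]
    intro l
    by_cases hl : l = k
    · subst hl
      rw [Function.update_self, hMult, mem_image]
      obtain ⟨j, hj⟩ := hx.2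
      have hx0 := (hx.1 l).1
      have hxn := (hx.1 l).2
      have hnz : ((n : ℕ) : ℤ) = r * bM m + 1 := by
        simp only [hn, fineN, bM]; push_cast; rw [Nat.cast_sub (by omega)]; push_cast; ring
      rw [hnz] at hxn
      have hj0 : 0 ≤ j := by
        by_contra h; push Not at h
        have : x l ≤ -bM m := by rw [hj]; nlinarith
        linarith
      have hjr : j ≤ r := by
        by_contra h; push Not at h
        have : (r + 1) * bM m ≤ x l := by rw [hj]; nlinarith
        linarith
      refine ⟨j.toNat, mem_range.2 (by omega), ?_⟩
      rw [Int.toNat_of_nonneg hj0, hj, mul_comm]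
    · rw [Function.update_of_ne hl, Finset.mem_Ico]
      exact hx.1 l
  refine (card_le_card hsub).trans ?_
  rw [Fintype.card_piFinset, ← Finset.mul_prod_erase univ _ (mem_univ k), Function.update_self]
  have h1 : #Mult ≤ r + 1 := card_image_le.trans (by rw [card_range])
  have h2 : ∏ l ∈ univ.erase k, #(Function.update (fun _ : Fin d => Finset.Ico (0 : ℤ) n) k Mult l) = n ^ (d - 1) := by
    rw [Finset.prod_congr rfl (fun l hl => by rw [Function.update_of_ne (ne_of_mem_erase hl)])]
    simp only [Int.card_Ico, sub_zero, Int.toNat_natCast, prod_const]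
    rw [card_erase_of_mem (mem_univ k), Finset.card_univ, Fintype.card_fin]
  rw [h2]
  exact Nat.mul_le_mul_right _ h1

/-- **The size of the boundary set** `A`: `|A| ≤ 2d · d(r+1)n^{d-1}` (printed: `|A| ≤ C n^d/m`). [cite: arXiv160201222, Thm. 14.3 (proof), "`|A| ≤ Cn^d/m`"] -/
theorem card_Abdry_le (hm : 2 ≤ m) :
    #(Abdry (d := d) m r) ≤ 2 * d * (d * ((r + 1) * (fineN m r) ^ (d - 1))) := by
  classical
  set n := fineN m r with hn
  set TV := (halfOpenBox d n).filter (Touch m) with hTV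
  have hTV : #TV ≤ d * ((r + 1) * n ^ (d - 1)) := by
    have hsub : TV ⊆ univ.biUnion fun k : Fin d => (halfOpenBox d n).filter fun x : ZSite d => bM m ∣ x k := by
      intro x hx
      rw [hTV, mem_filter] at hx
      obtain ⟨k, hk⟩ := hx.2
      exact mem_biUnion.2 ⟨k, mem_univ _, mem_filter.2 ⟨hx.1, hk⟩⟩
    refine (card_le_card hsub).trans (card_biUnion_le.trans ?_)
    calc ∑ k : Fin d, #((halfOpenBox d n).filter fun x : ZSite d => bM m ∣ x k)
        ≤ ∑ _k : Fin d, (r + 1) * n ^ (d - 1) := Finset.sum_le_sum fun k _ => card_filter_dvd_le hm k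
      _ = d * ((r + 1) * n ^ (d - 1)) := by rw [sum_const, Finset.card_univ, Fintype.card_fin, smul_eq_mul]
  -- split `A` by which endpoint touches
  set Asrc := (Abdry (d := d) m r).filter fun i => Touch m i.1.1.1 with hAsrc
  set Atgt := (Abdry (d := d) m r).filter fun i => Touch m (i.1.1.1 + Pi.single i.1.1.2 1) with hAtgt
  have hsplit : Abdry (d := d) m r ⊆ Asrc ∪ Atgt := by
    intro i hi
    have h := (mem_filter.1 hi).2
    rcases h with h | h
    · exact mem_union_left _ (mem_filter.2 ⟨hi, h⟩)
    · exact mem_union_right _ (mem_filter.2 ⟨hi, h⟩)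
  have hsrc : #Asrc ≤ #TV * d := by
    have h := card_le_card_of_injOn (s := Asrc) (t := TV ×ˢ (univ : Finset (Fin d)))
      (fun i => (i.1.1.1, i.1.1.2)) (fun i hi => by
        rw [Finset.mem_coe, hAsrc, mem_filter] at hi
        rw [Finset.mem_coe, mem_product]
        refine ⟨mem_filter.2 ⟨?_, hi.2⟩, mem_univ _⟩
        exact (mem_boxEdges.1 (mem_boxEdgesAt_zero.1 i.1.2)).1)
      (fun i _ j _ h => by
        simp only [Prod.mk.injEq] at h
        exact Subtype.ext (Subtype.ext (Prod.ext h.1 h.2)))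
    rwa [card_product, Finset.card_univ, Fintype.card_fin] at h
  have htgt : #Atgt ≤ #TV * d := by
    have h := card_le_card_of_injOn (s := Atgt) (t := TV ×ˢ (univ : Finset (Fin d)))
      (fun i => (i.1.1.1 + Pi.single i.1.1.2 1, i.1.1.2)) (fun i hi => by
        rw [Finset.mem_coe, hAtgt, mem_filter] at hi
        rw [Finset.mem_coe, mem_product]
        refine ⟨mem_filter.2 ⟨?_, hi.2⟩, mem_univ _⟩
        exact (mem_boxEdges.1 (mem_boxEdgesAt_zero.1 i.1.2)).2)
      (fun i _ j _ h => by
        simp only [Prod.mk.injEq] at h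
        have h2 := h.2
        have h1 : i.1.1.1 = j.1.1.1 := by
          have := h.1; rw [h2] at this; exact add_right_cancel this
        exact Subtype.ext (Subtype.ext (Prod.ext h1 h2)))
    rwa [card_product, Finset.card_univ, Fintype.card_fin] at h
  calc #(Abdry (d := d) m r) ≤ #(Asrc ∪ Atgt) := card_le_card hsplit
    _ ≤ #Asrc + #Atgt := card_union_le _ _
    _ ≤ #TV * d + #TV * d := add_le_add hsrc htgt
    _ = 2 * d * #TV := by ring
    _ ≤ 2 * d * (d * ((r + 1) * n ^ (d - 1))) := Nat.mul_le_mul_left _ hTV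

/-- The size of `A` in the printed form `|A| ≤ 4d² n^d/(m-1)` (real numbers, `r ≥ 1`). [cite: arXiv160201222, Thm. 14.3 (proof)] -/
theorem card_Abdry_le_real (hm : 2 ≤ m) (hr : 1 ≤ r) :
    (#(Abdry (d := d) m r) : ℝ) ≤ 4 * (d : ℝ) ^ 2 * (fineN m r : ℝ) ^ d / ((m : ℝ) - 1) := by
  have h := card_Abdry_le (d := d) (r := r) hm
  have hM : (0 : ℝ) < (m : ℝ) - 1 := by
    have : (2 : ℝ) ≤ m := by exact_mod_cast hm
    linarith
  set n := fineN m r with hn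
  have hn1 : (n : ℝ) = r * ((m : ℝ) - 1) + 1 := by
    simp only [hn, fineN]; push_cast; rw [Nat.cast_sub (by omega)]; push_cast; ring
  have hnpos : (0 : ℝ) < n := by rw [hn1]; positivity
  have hcast : (#(Abdry (d := d) m r) : ℝ) ≤ 2 * d * (d * ((r + 1) * (n : ℝ) ^ (d - 1))) := by exact_mod_cast h
  refine hcast.trans ?_
  rw [le_div_iff₀ hM]
  -- `2d·d(r+1)n^{d-1}(m-1) ≤ 4d² n^d`: use `(r+1)(m-1) ≤ 2r(m-1) ≤ 2n` and `n^{d-1} n = n^d` (for `d ≥ 1`)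
  rcases Nat.eq_zero_or_pos d with hd | hd
  · subst hd; simp
  · have hpow : (n : ℝ) ^ d = (n : ℝ) ^ (d - 1) * n := by
      rw [← pow_succ, Nat.sub_add_cancel hd]
    have hr1 : (1 : ℝ) ≤ r := by exact_mod_cast hr
    have hkey : ((r : ℝ) + 1) * ((m : ℝ) - 1) ≤ 2 * n := by rw [hn1]; nlinarith
    have hnn : (0 : ℝ) ≤ (n : ℝ) ^ (d - 1) := by positivity
    calc 2 * (d : ℝ) * (d * ((r + 1) * (n : ℝ) ^ (d - 1))) * ((m : ℝ) - 1)
        = 2 * (d : ℝ) ^ 2 * (n : ℝ) ^ (d - 1) * (((r : ℝ) + 1) * ((m : ℝ) - 1)) := by ring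
      _ ≤ 2 * (d : ℝ) ^ 2 * (n : ℝ) ^ (d - 1) * (2 * n) := by gcongr
      _ = 4 * (d : ℝ) ^ 2 * (n : ℝ) ^ d := by rw [hpow]; ring

end Counting

end LatticeMaxwell

end Literature.MathematicalPhysics.QuantumFieldTheory
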